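import Mathlib
import HarnessLib.Audit

/-!
# Rung C1 of the crux `EulerZoomLiouville.PowerGaugeEulerLiouville`, NO-DRIFT lane (2b/3): LEMMAS for the drift chart
# (inner-product helpers, the «constant along a line» derivative lemma, the estimate's bookkeeping, regularity of
# the chart `Θ`, uniform constants along the arc)

Route №10 `EulerZoomLiouville` (NavierStokesRegularity), crux E = stmt-NavierStokesRegularity-19832, tenure rung C1,
registered residue `stub_selfSimilarExtremalRest`.  Lineage ns-typeII-p2 (gen 7).  GENERIC CALCULUS (no profile, no
flow); consumed by `…SelfSimilarDriftChart` (2c/3), whose module docstring explains the construction: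
`Θ(v) = c(⟪e, v⟫) + DW(c ⟪e, v⟫)(v − ⟪e, v⟫ e)` around an interior point `c(t₀)` of an arc of zeros of a `C²` field
`W`, `f = ⟪e, Θ⁻¹ ·⟫`, and `|Df(y) W(y)| ≤ K ‖W y‖²` on a tube.

* `fderiv_apply_eq_zero_of_eventually_const` — if `s ↦ f(y + s k)` is constant near `0` then `Df(y) k = 0`;
* `drift_bound_algebra` — the real-number bookkeeping turning `μ‖h‖ ≤ ‖L L h‖`, `‖L h‖ ≤ Λ‖h‖`, the Taylor bound and
  `|Df R| ≤ C_f ‖R‖` into `|Df W| ≤ K ‖W‖²`;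
* `chart_regularity` — `Θ` is `C¹` on `{⟪e,v⟫ ∈ (a,b)}` with `DΘ(t₀ e) = ⟪e,·⟫(c'(t₀) − DW(c t₀) e) + DW(c t₀)`;
* `exists_arc_radius` — for `t` near `t₀`: `t ∈ (a,b)`, `‖L_t‖ ≤ Λ`, `⟪e, c'(t)⟫ ≠ 0`, `‖L_t L_t h‖ ≥ μ‖h‖` (`h ⊥ e`).

WHAT THIS IS NOT: not NS, not E, not rung C1 — calculus. [folklore]
-/

noncomputable section

open Set Filter Metric Function
open scoped Topology RealInnerProductSpace NNReal

-- flat `Theorems/<Route><Decl>…` files of one crux share the namespace of the crux (tree convention)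
set_option linter.dupNamespace false

namespace Summit.NavierStokesRegularity.NavierStokesRegularity.Theorems.PowerGaugeEulerLiouville.NoDrift

/-! ### Small inner-product helpers -/

section Helpers

variable {E : Type*} [NormedAddCommGroup E] [InnerProductSpace ℝ E]

/-- `v ↦ ⟪e, v⟫` has derivative `⟪e, ·⟫`. [folklore] -/
theorem hasFDerivAt_inner_left (e v : E) : HasFDerivAt (fun v : E => (⟪e, v⟫ : ℝ)) (innerSL ℝ e) v := by
  have h := (hasFDerivAt_const e v).inner ℝ (hasFDerivAt_id v)
  refine h.congr_fderiv ?_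
  ext w
  simp [fderivInnerCLM_apply]

/-- `⟪e, t e⟫ = t` for a unit vector. [folklore] -/
theorem inner_smul_self_unit {e : E} (he : ‖e‖ = 1) (t : ℝ) : (⟪e, t • e⟫ : ℝ) = t := by
  rw [inner_smul_right, real_inner_self_eq_norm_sq, he]; ring

/-- The component orthogonal to a unit vector is orthogonal to it. [folklore] -/
theorem inner_proj_eq_zero {e : E} (he : ‖e‖ = 1) (w : E) : (⟪e, w - (⟪e, w⟫ : ℝ) • e⟫ : ℝ) = 0 := by
  rw [inner_sub_right, inner_smul_right, real_inner_self_eq_norm_sq, he]; ring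

/-- The component orthogonal to a unit vector is not longer than the vector. [folklore] -/
theorem norm_proj_le {e : E} (he : ‖e‖ = 1) (w : E) : ‖w - (⟪e, w⟫ : ℝ) • e‖ ≤ ‖w‖ := by
  have h1 : ‖w - (⟪e, w⟫ : ℝ) • e‖ ^ 2 = ‖w‖ ^ 2 - (⟪e, w⟫ : ℝ) ^ 2 := by
    rw [norm_sub_sq_real, norm_smul, he, mul_one, inner_smul_right, real_inner_comm, Real.norm_eq_abs,
      sq_abs]
    ring
  have h2 : ‖w - (⟪e, w⟫ : ℝ) • e‖ ^ 2 ≤ ‖w‖ ^ 2 := by rw [h1]; nlinarith [sq_nonneg (⟪e, w⟫ : ℝ)]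
  exact (sq_le_sq₀ (norm_nonneg _) (norm_nonneg _)).1 h2

/-- Distance between multiples of a unit vector. [folklore] -/
theorem dist_smul_unit {e : E} (he : ‖e‖ = 1) (a b : ℝ) : dist (a • e) (b • e) = |a - b| := by
  rw [dist_eq_norm, ← sub_smul, norm_smul, he, mul_one, Real.norm_eq_abs]

/-- The orthogonal component of a difference with a multiple of `e`. [folklore] -/
theorem proj_sub_smul {e : E} (he : ‖e‖ = 1) (w : E) (t : ℝ) :
    (w - t • e) - (⟪e, w - t • e⟫ : ℝ) • e = w - (⟪e, w⟫ : ℝ) • e := by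
  rw [inner_sub_right, inner_smul_self_unit he, sub_smul]
  abel

end Helpers

/-- A function that is constant along a line through `y` (for small parameters) has zero derivative in that
direction. [folklore] -/
theorem fderiv_apply_eq_zero_of_eventually_const {F : Type*} [NormedAddCommGroup F] [NormedSpace ℝ F]
    {f : F → ℝ} {y k : F} {t : ℝ} (hf : DifferentiableAt ℝ f y)
    (hconst : ∀ᶠ s in 𝓝 (0 : ℝ), f (y + s • k) = t) : fderiv ℝ f y k = 0 := by
  have hd1 : HasDerivAt (fun s : ℝ => f (y + s • k)) 0 0 :=
    (hasDerivAt_const (0 : ℝ) t).congr_of_eventuallyEq hconst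
  have hd2 : HasDerivAt (fun s : ℝ => f (y + s • k)) (fderiv ℝ f y k) 0 := by
    have h1 : HasDerivAt (fun s : ℝ => y + s • k) k 0 := by
      simpa using ((hasDerivAt_id (0 : ℝ)).smul_const k).const_add y
    have h2 : HasFDerivAt f (fderiv ℝ f y) (y + (0 : ℝ) • k) := by
      rw [zero_smul, add_zero]; exact hf.hasFDerivAt
    exact h2.comp_hasDerivAt (0 : ℝ) h1
  exact hd2.unique hd1


/-- Along an arc of zeros the derivative kills the tangent: if `W ∘ c = 0` on the open interval `(a, b) ∋ t` then
`DW(c t) (c' t) = 0` (`W` differentiable, `c` differentiable at `t`). [folklore] -/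
theorem fderiv_apply_deriv_eq_zero_of_zero_on {F : Type*} [NormedAddCommGroup F] [NormedSpace ℝ F]
    {W : F → F} (hWd : Differentiable ℝ W) {c : ℝ → F} {a b t : ℝ} (ht : t ∈ Ioo a b)
    (hcd : HasDerivAt c (deriv c t) t) (harc : ∀ s ∈ Ioo a b, W (c s) = 0) :
    fderiv ℝ W (c t) (deriv c t) = 0 := by
  have h1 : HasDerivAt (fun s => W (c s)) (fderiv ℝ W (c t) (deriv c t)) t :=
    ((hWd (c t)).hasFDerivAt).comp_hasDerivAt t hcd
  have h2 : HasDerivAt (fun s => W (c s)) 0 t := by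
    refine (hasDerivAt_const t (0 : F)).congr_of_eventuallyEq ?_
    filter_upwards [isOpen_Ioo.mem_nhds ht] with s hs
    exact harc s hs
  exact h1.unique h2

/-- The real-number bookkeeping of the drift estimate: from `μ‖h‖ ≤ ‖k‖`, `‖Lh‖ ≤ Λ‖h‖`, `‖R‖ ≤ M‖Lh‖²`,
`MΛ²‖h‖ ≤ μ/2`, `‖k‖ ≤ ‖W‖ + ‖R‖` and `|D| ≤ Cf ‖R‖` conclude `|D| ≤ (Cf M (2Λ/μ)² + 1) ‖W‖²`. [folklore] -/
theorem drift_bound_algebra {μ Λ M Cf nh nLh nk nR nW nD : ℝ} (hμ : 0 < μ) (hΛ : 0 < Λ) (hM : 0 ≤ M)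
    (hCf : 0 ≤ Cf) (hnh : 0 ≤ nh) (hnLh : 0 ≤ nLh) (hk : μ * nh ≤ nk) (hLh : nLh ≤ Λ * nh)
    (hR : nR ≤ M * nLh ^ 2) (hsmall : M * Λ ^ 2 * nh ≤ μ / 2) (hkW : nk ≤ nW + nR) (hD : nD ≤ Cf * nR) :
    nD ≤ (Cf * M * (2 * Λ / μ) ^ 2 + 1) * nW ^ 2 := by
  -- `nR ≤ (μ/2) nh`, hence `(μ/2) nh ≤ nW` and `nLh ≤ (2Λ/μ) nW`
  have h1 : nR ≤ μ / 2 * nh := by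
    have h2 : M * nLh ^ 2 ≤ M * (Λ * nh) ^ 2 := mul_le_mul_of_nonneg_left (pow_le_pow_left₀ hnLh hLh 2) hM
    nlinarith
  have h3 : μ / 2 * nh ≤ nW := by linarith
  have h4 : nLh ≤ 2 * Λ / μ * nW := by
    rw [div_mul_eq_mul_div, le_div_iff₀ hμ]
    nlinarith
  have h5 : nLh ^ 2 ≤ (2 * Λ / μ) ^ 2 * nW ^ 2 := by
    rw [← mul_pow]; exact pow_le_pow_left₀ hnLh h4 2
  calc nD ≤ Cf * nR := hD
    _ ≤ Cf * (M * nLh ^ 2) := mul_le_mul_of_nonneg_left hR hCf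
    _ ≤ Cf * (M * ((2 * Λ / μ) ^ 2 * nW ^ 2)) := mul_le_mul_of_nonneg_left (mul_le_mul_of_nonneg_left h5 hM) hCf
    _ = (Cf * M * (2 * Λ / μ) ^ 2) * nW ^ 2 := by ring
    _ ≤ (Cf * M * (2 * Λ / μ) ^ 2 + 1) * nW ^ 2 := by nlinarith [sq_nonneg nW]


/-! ### Regularity of the chart `Θ(v) = c ⟪e,v⟫ + DW(c ⟪e,v⟫)(v − ⟪e,v⟫ e)` -/

section ChartRegularity

variable {E : Type*} [NormedAddCommGroup E] [InnerProductSpace ℝ E]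

/-- The chart `Θ(v) = c(⟪e, v⟫) + DW(c ⟪e, v⟫)(v − ⟪e, v⟫ e)` is `C¹` on `{⟪e, v⟫ ∈ (a, b)}` and has derivative
`⟪e, ·⟫ (c'(t₀) − DW(c t₀) e) + DW(c t₀)` at `t₀ e` (`W ∈ C²`, `c ∈ C¹((a,b))`, `‖e‖ = 1`). [folklore] -/
theorem chart_regularity {W : E → E} (hW : ContDiff ℝ 2 W) {a b t₀ : ℝ} (ht₀ : t₀ ∈ Ioo a b) {c : ℝ → E}
    (hc : ContDiffOn ℝ 1 c (Ioo a b)) {e : E} (he : ‖e‖ = 1) :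
    ContDiffOn ℝ 1 (fun v : E => c ⟪e, v⟫ + fderiv ℝ W (c ⟪e, v⟫) (v - (⟪e, v⟫ : ℝ) • e))
        ((fun v : E => (⟪e, v⟫ : ℝ)) ⁻¹' Ioo a b) ∧
      HasFDerivAt (fun v : E => c ⟪e, v⟫ + fderiv ℝ W (c ⟪e, v⟫) (v - (⟪e, v⟫ : ℝ) • e))
        ((innerSL ℝ e).smulRight (deriv c t₀ - fderiv ℝ W (c t₀) e) + fderiv ℝ W (c t₀)) (t₀ • e) := by
  set τ₁ : E → ℝ := fun v => ⟪e, v⟫ with hτ₁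
  set P : E → E := fun v => v - (⟪e, v⟫ : ℝ) • e with hPdef
  set L : ℝ → E →L[ℝ] E := fun t => fderiv ℝ W (c t) with hLdef
  set v₀ : E := t₀ • e with hv₀
  have hτ₁v₀ : τ₁ v₀ = t₀ := inner_smul_self_unit he t₀
  have hPv₀ : P v₀ = 0 := by
    simp only [hPdef, hv₀, inner_smul_self_unit he]; exact sub_self _
  have hIoo : IsOpen (Ioo a b) := isOpen_Ioo
  have hDW : ContDiff ℝ 1 (fderiv ℝ W) := hW.fderiv_right (m := 1) le_rfl
  have hDWd : Differentiable ℝ (fderiv ℝ W) := hDW.differentiable (by simp)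
  have hτ₁c : ContDiff ℝ 1 τ₁ := contDiff_const.inner ℝ contDiff_id
  have hPc : ContDiff ℝ 1 P := contDiff_id.sub (hτ₁c.smul contDiff_const)
  have hcτ : ContDiffOn ℝ 1 (fun v => c (τ₁ v)) (τ₁ ⁻¹' Ioo a b) := hc.comp hτ₁c.contDiffOn fun v hv => hv
  have hLτ : ContDiffOn ℝ 1 (fun v => L (τ₁ v)) (τ₁ ⁻¹' Ioo a b) := hDW.comp_contDiffOn hcτ
  refine ⟨hcτ.add (hLτ.clm_apply hPc.contDiffOn), ?_⟩
  have hcd : HasDerivAt c (deriv c t₀) t₀ :=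
    ((hc.differentiableOn (by simp)).differentiableAt (hIoo.mem_nhds ht₀)).hasDerivAt
  have hτ₁' : HasFDerivAt τ₁ (innerSL ℝ e) v₀ := hasFDerivAt_inner_left e v₀
  have h1 : HasFDerivAt (fun v => c (τ₁ v))
      ((ContinuousLinearMap.smulRight (1 : ℝ →L[ℝ] ℝ) (deriv c t₀)).comp (innerSL ℝ e)) v₀ := by
    have hcd₀ : HasFDerivAt c (ContinuousLinearMap.smulRight (1 : ℝ →L[ℝ] ℝ) (deriv c t₀)) (τ₁ v₀) := by
      rw [hτ₁v₀]; exact hcd.hasFDerivAt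
    exact hcd₀.comp v₀ hτ₁'
  have h2 : HasFDerivAt (fun v => L (τ₁ v))
      ((fderiv ℝ (fderiv ℝ W) (c (τ₁ v₀))).comp
        ((ContinuousLinearMap.smulRight (1 : ℝ →L[ℝ] ℝ) (deriv c t₀)).comp (innerSL ℝ e))) v₀ :=
    ((hDWd (c (τ₁ v₀))).hasFDerivAt).comp v₀ h1
  have hP' : HasFDerivAt P (ContinuousLinearMap.id ℝ E - (innerSL ℝ e).smulRight e) v₀ :=
    (hasFDerivAt_id v₀).sub (hτ₁'.smul_const e)
  have h3 := h2.clm_apply hP'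
  have h4 := h1.add h3
  refine h4.congr_fderiv ?_
  rw [hPv₀, hτ₁v₀]
  ext u
  simp [smul_sub]
  abel

/-- **Uniform constants along the arc.**  If `t ↦ L t` and `t ↦ d t` are continuous on `(a, b) ∋ t₀`,
`⟪e, d t₀⟫ ≠ 0`, and `L t₀ ∘ L t₀ + ⟪e, ·⟫ d t₀` is a linear homeomorphism, then for `t` in a neighbourhood of
`t₀`: `t ∈ (a, b)`, `‖L t‖ ≤ Λ`, `⟪e, d t⟫ ≠ 0`, and `‖L t (L t h)‖ ≥ μ ‖h‖` for all `h ⊥ e` (continuity of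
`t ↦ L t ∘ L t` in operator norm; `μ = 1 / (2(‖N₀⁻¹‖ + 1))`). [folklore] -/
theorem exists_arc_radius {L : ℝ → E →L[ℝ] E} {a b t₀ : ℝ} (ht₀ : t₀ ∈ Ioo a b)
    (hLcont : ContinuousOn L (Ioo a b)) {d : ℝ → E} (hdc : ContinuousOn d (Ioo a b)) {e : E}
    (hec : (⟪e, d t₀⟫ : ℝ) ≠ 0) (N₀ : E ≃L[ℝ] E)
    (hN₀ : (N₀ : E →L[ℝ] E) = (L t₀).comp (L t₀) + (innerSL ℝ e).smulRight (d t₀)) :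
    ∃ μ Λ η₀ : ℝ, 0 < μ ∧ 0 < Λ ∧ 0 < η₀ ∧ ∀ t : ℝ, |t - t₀| < η₀ →
      t ∈ Ioo a b ∧ ‖L t‖ ≤ Λ ∧ (⟪e, d t⟫ : ℝ) ≠ 0 ∧
        ∀ h : E, (⟪e, h⟫ : ℝ) = 0 → μ * ‖h‖ ≤ ‖L t (L t h)‖ := by
  have hIoo : IsOpen (Ioo a b) := isOpen_Ioo
  set μ : ℝ := 1 / (2 * (‖(N₀.symm : E →L[ℝ] E)‖ + 1)) with hμdef
  have hμ : 0 < μ := by rw [hμdef]; positivity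
  have hN₀lower : ∀ w : E, 2 * μ * ‖w‖ ≤ ‖N₀ w‖ := by
    intro w
    have h1 : ‖w‖ ≤ ‖(N₀.symm : E →L[ℝ] E)‖ * ‖N₀ w‖ := by
      have h := (N₀.symm : E →L[ℝ] E).le_opNorm (N₀ w)
      rwa [show (N₀.symm : E →L[ℝ] E) (N₀ w) = w from N₀.symm_apply_apply w] at h
    have h2 : 2 * μ * (‖(N₀.symm : E →L[ℝ] E)‖ + 1) = 1 := by rw [hμdef]; field_simp
    have h3 : ‖w‖ ≤ (‖(N₀.symm : E →L[ℝ] E)‖ + 1) * ‖N₀ w‖ := by nlinarith [norm_nonneg (N₀ w)]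
    calc 2 * μ * ‖w‖ ≤ 2 * μ * ((‖(N₀.symm : E →L[ℝ] E)‖ + 1) * ‖N₀ w‖) :=
          mul_le_mul_of_nonneg_left h3 (by positivity)
      _ = ‖N₀ w‖ := by rw [← mul_assoc, h2, one_mul]
  set Nt : ℝ → E →L[ℝ] E := fun t => (L t).comp (L t) + (innerSL ℝ e).smulRight (d t₀) with hNtdef
  have hNt₀ : Nt t₀ = (N₀ : E →L[ℝ] E) := by rw [hN₀]
  have hNcont : ContinuousOn Nt (Ioo a b) := (hLcont.clm_comp hLcont).add continuousOn_const
  set Λ : ℝ := ‖L t₀‖ + 1 with hΛdef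
  have hΛ : 0 < Λ := by rw [hΛdef]; positivity
  have e1 : ∀ᶠ t in 𝓝 t₀, t ∈ Ioo a b := hIoo.mem_nhds ht₀
  have e2 : ∀ᶠ t in 𝓝 t₀, ‖Nt t - Nt t₀‖ ≤ μ := by
    have h : ContinuousAt Nt t₀ := (hNcont t₀ ht₀).continuousAt (hIoo.mem_nhds ht₀)
    have h' := (Metric.tendsto_nhds.1 h.tendsto) μ hμ
    filter_upwards [h'] with t ht
    rw [dist_eq_norm] at ht; exact ht.le
  have e3 : ∀ᶠ t in 𝓝 t₀, ‖L t‖ ≤ Λ := by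
    have h : ContinuousAt L t₀ := (hLcont t₀ ht₀).continuousAt (hIoo.mem_nhds ht₀)
    have h' := (Metric.tendsto_nhds.1 h.tendsto) 1 one_pos
    filter_upwards [h'] with t ht
    rw [dist_eq_norm] at ht
    calc ‖L t‖ = ‖(L t - L t₀) + L t₀‖ := by rw [sub_add_cancel]
      _ ≤ ‖L t - L t₀‖ + ‖L t₀‖ := norm_add_le _ _
      _ ≤ Λ := by rw [hΛdef]; linarith only [ht]
  have e4 : ∀ᶠ t in 𝓝 t₀, (⟪e, d t⟫ : ℝ) ≠ 0 := by
    have h : ContinuousAt (fun t => (⟪e, d t⟫ : ℝ)) t₀ :=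
      continuousAt_const.inner ((hdc t₀ ht₀).continuousAt (hIoo.mem_nhds ht₀))
    exact h.eventually_ne hec
  obtain ⟨η₀, hη₀, hball⟩ := Metric.eventually_nhds_iff.1 (e1.and (e2.and (e3.and e4)))
  refine ⟨μ, Λ, η₀, hμ, hΛ, hη₀, fun t ht => ?_⟩
  obtain ⟨htI, hN, hLt, hdt⟩ := hball (by rw [Real.dist_eq]; exact ht)
  refine ⟨htI, hLt, hdt, fun h hh => ?_⟩
  have h1 : Nt t h = L t (L t h) := by
    change L t (L t h) + (⟪e, h⟫ : ℝ) • d t₀ = L t (L t h)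
    rw [hh, zero_smul, add_zero]
  have h2 : ‖(Nt t - Nt t₀) h‖ ≤ μ * ‖h‖ := ((Nt t - Nt t₀).le_opNorm h).trans
    (mul_le_mul_of_nonneg_right hN (norm_nonneg _))
  have h3 : 2 * μ * ‖h‖ ≤ ‖Nt t₀ h‖ := by rw [hNt₀]; exact hN₀lower h
  have h4 : ‖Nt t₀ h‖ ≤ ‖Nt t h‖ + ‖(Nt t - Nt t₀) h‖ := by
    have : Nt t₀ h = Nt t h - (Nt t - Nt t₀) h := by
      change Nt t₀ h = Nt t h - (Nt t h - Nt t₀ h); abel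
    rw [this]; exact norm_sub_le _ _
  rw [← h1]; linarith only [h2, h3, h4]

end ChartRegularity

end Summit.NavierStokesRegularity.NavierStokesRegularity.Theorems.PowerGaugeEulerLiouville.NoDrift

end
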